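import Literature.NumberTheory.Automorphic.LieAlgebraGLStabilizer
import Literature.NumberTheory.Automorphic.LieAlgebraGLTorusHull
import Literature.NumberTheory.Automorphic.NilpotentExpRootHom
import Literature.NumberTheory.Automorphic.LinearAlgebraicGroupsProofs
import HarnessLib

/-!
# The block-diagonal embedding `GL_n × GL_{n'} ↪ GL_{n + n'}`: products of linear algebraic groups
(trunk T-AUTOMORPHIC, G25 AutomorphicL; step 1 of the graph proof of `chevalley_isomorphism_abstract`)

The concrete `k`-points vocabulary of `LinearAlgebraicGroups.lean` knows algebraic groups only as
subgroups `G ≤ GL n k` of *one* general linear group. The graph proof of the isomorphism theorem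
(named fact `chevalley_isomorphism_abstract` of `ReductiveDualProofs.lean`, Springer, *Linear
Algebraic Groups*, 2nd ed., 9.6.2, step 1; the graph method of Chevalley / Humphreys, *Linear
Algebraic Groups*, §33 / Steinberg, *Lectures on Chevalley groups*, §10) works inside the product
`G × G'` of two such groups `G ≤ GL_n`, `G' ≤ GL_{n'}`. This file realises the product inside
`GL (n ⊕ n') k` by block-diagonal matrices and transports the basic notions:

* `blockDiagGL : GL n k × GL n' k →* GL (n ⊕ n') k`, `(g, g') ↦ diag(g, g')`
  (`Matrix.fromBlocks g 0 0 g'`), injective; its range `blockDiagRange` (the matrices with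
  vanishing off-diagonal blocks, `mem_blockDiagRange_iff`) with the two block projections
  `fstBlockGL`, `sndBlockGL : blockDiagRange →* GL`, and the product subgroup
  `prodBlock G G' = (G × G').map blockDiagGL`;
* coordinates: the substitutions `fstCoordPoly`, `sndCoordPoly` expressing the coordinates
  `x_{ij}, det⁻¹` of a block through those of the big matrix (`det(g)⁻¹ = det(diag(g,g'))⁻¹ ·
  det g'`), with their evaluation lemmas; hence **`prodBlock G G'` is algebraic when `G`, `G'`
  are** (`isAlgebraicSubgroup_prodBlock`) and the block projections of an algebraic subgroup are
  algebraic homomorphisms (`isAlgebraicGL_fstBlockGL_comp`, `isAlgebraicGL_sndBlockGL_comp`),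
  as are the two embeddings (`isAlgebraicGL_blockDiagGL_inl/inr`-type statements
  `isAlgebraicGL_inlBlock`, `isAlgebraicGL_inrBlock`);
* Lie algebras (Springer 4.4.10 (3) for the closed subgroup `G × G' ≤ GL_{n+n'}`): the
  `k[ε]`-point `1 + ε Ã` of `GL (n ⊕ n')` restricts blockwise
  (`aeval_dualPoint_fstCoordPoly`: the `det⁻¹`-coordinate works out because
  `(1 - ε tr Ã)(1 + ε tr Ã₂₂) = 1 - ε tr Ã₁₁`), whence **`Lie(prodBlock G G') ⊆ Lie(G) ⊕ Lie(G')`**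
  in block-diagonal position (`toBlocks₁₁_mem_lieAlgebraGL`, `toBlocks₂₂_mem_lieAlgebraGL`,
  `eq_fromBlocks_of_mem_lieAlgebraGL_prodBlock`);
* elementwise transport: conjugation (`blockDiagGL_conj_fromBlocks`), semisimplicity
  (`IsSemisimpleElt.blockDiagGL`, through simultaneous diagonalisation,
  `exists_conj_le_diagonalSubgroup`), powers and exponentials of block-diagonal nilpotent matrices
  (`fromBlocks_zero_pow`, `exp_smul_fromBlocks`, `expHom_fromBlocks`).

Everything is proved; no named fact is introduced. [folklore] throughout (Springer 1.1, 2.1.4,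
4.4.10 (3) for products of affine varieties / closed subgroups of `GL_n`).

## Relation to existing block-diagonal devices in this directory (library fit)

Two block-diagonal constructions already exist in `Literature/NumberTheory/Automorphic/` and the
present two-block, `Sum`-indexed one is a *special case of the first up to reindexing*:

* `ParabolicGL.lean`: `blockDiagonalGL R c : (Π a, GL {i // c i = a} R) →* GL n R` — the Levi
  embedding attached to a colouring `c : n → α` of **one** index type (blocks are the fibres
  `{i // c i = a}`), with the block projections `leviProjection R c` on the standard parabolic
  `standardParabolicGL R c` (Bernstein–Zelevinsky §2.1). Taking the index type `n ⊕ n'` and the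
  two-colouring `Sum.elim (fun _ => false) (fun _ => true)`, and reindexing the fibres
  `{i // _} ≃ n`, `≃ n'`, recovers `blockDiagGL` / `fstBlockGL` / `sndBlockGL` below;
* `ChevalleyGroupBasic.lean`: `blockDiagSubgroup ≤ GL (Σ j, mb j) k` — the `Σ`-typed subgroup of
  invertible matrices that are block diagonal together with their inverse (used for the weight
  blocks of the Chevalley group of the existence theorem); `blockDiagRange` below is its
  two-block instance (for `j : Bool`), again up to the reindexing `(Σ j : Bool, _) ≃ n ⊕ n'`.

The `Matrix.fromBlocks` / `n ⊕ n'` formulation is chosen here because the graph argument needs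
two blocks of *different, unrelated* index types `n`, `n'` (the ambient `GL_n ⊇ G` and
`GL_{n'} ⊇ G'`), for which Mathlib's `fromBlocks` API (`fromBlocks_multiply`,
`det_fromBlocks_zero₂₁`, `fromBlocks_toBlocks`, `fromBlocks_diagonal`) computes directly, whereas
both existing devices would force a detour through subtypes of a common index type. In a later
librarian unification the general `ParabolicGL.blockDiagonalGL` is the construction intended to
survive, with `blockDiagGL` re-expressed as its two-colour instance composed with the fibre
reindexings (bridge lemmas `blockDiagGL (g, g') = blockDiagonalGL k c (…)` are not provided here
to keep the import closure of the graph proof small — `ParabolicGL.lean` is not imported). What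
is new in this file and exists nowhere else in the tree: the algebraicity transport
(`fstCoordPoly`, `isAlgebraicSubgroup_prodBlock`, algebraic projections/embeddings), the
dual-number computation `Lie(G × G') ⊆ Lie(G) ⊕ Lie(G')`, and the blockwise exponential /
semisimplicity lemmas.

## Mathlib

`Matrix.fromBlocks` with `fromBlocks_multiply`, `fromBlocks_one`, `fromBlocks_inj`,
`fromBlocks_toBlocks`, `det_fromBlocks_zero₂₁`, `fromBlocks_diagonal`, `MonoidHom.ofInjective`,
`IsNilpotent.exp`. Mathlib has `Matrix.blockDiagonal`/`blockDiagonal'` (families of blocks over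
one index type, used by the two devices above) but no algebraic groups. Searched: `fromBlocks` +
`GeneralLinearGroup`, `blockDiagonal` (hits: `ParabolicGL.blockDiagonalGL`,
`ChevalleyGroupBasic.blockDiagSubgroup`, `RootDataGLn`/`ReductiveDualGLn` block `SL₂`s),
`blockDiagGL`, `prodBlock`.

## References

* [SpringerLAG1998] T. A. Springer, *Linear Algebraic Groups*, 2nd ed., Progress in Mathematics
  9, Birkhäuser (1998): 1.1.1, 2.1.4, 4.1.9 (3), 4.4.10 (3), Theorem 9.6.2.
* J. E. Humphreys, *Linear Algebraic Groups*, GTM 21, Springer (1975), §33 (the subgroup of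
  `G × G'`).
-/

noncomputable section

open scoped MatrixGroups
open Matrix TrivSqZeroExt

namespace Literature.NumberTheory.Automorphic

variable {k : Type*} [Field k] {n n' : Type*} [Fintype n] [DecidableEq n] [Fintype n']
  [DecidableEq n']

/-! ### Block-diagonal matrices -/

section Matrices

omit [DecidableEq n] [DecidableEq n'] in
/-- Products of block-diagonal matrices. [folklore] -/
lemma fromBlocks_zero_mul_fromBlocks_zero {R : Type*} [NonUnitalNonAssocSemiring R]
    (A A' : Matrix n n R) (B B' : Matrix n' n' R) :
    fromBlocks A 0 0 B * fromBlocks A' 0 0 B' = fromBlocks (A * A') 0 0 (B * B') := by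
  rw [fromBlocks_multiply]
  simp

omit [DecidableEq n] [DecidableEq n'] in
/-- The trace of a block matrix is the sum of the traces of its diagonal blocks. [folklore] -/
lemma trace_fromBlocks {R : Type*} [AddCommMonoid R] (A : Matrix n n R)
    (B : Matrix n n' R) (C : Matrix n' n R) (D : Matrix n' n' R) :
    (fromBlocks A B C D).trace = A.trace + D.trace := by
  simp [Matrix.trace, Fintype.sum_sum_type]

omit [DecidableEq n] [DecidableEq n'] in
/-- Powers of block-diagonal matrices. [folklore] -/
lemma fromBlocks_zero_pow {R : Type*} [Semiring R] [DecidableEq n] [DecidableEq n']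
    (A : Matrix n n R) (B : Matrix n' n' R) (i : ℕ) :
    (fromBlocks A 0 0 B) ^ i = fromBlocks (A ^ i) 0 0 (B ^ i) := by
  induction i with
  | zero => simp
  | succ i ih => rw [pow_succ, ih, fromBlocks_zero_mul_fromBlocks_zero, ← pow_succ, ← pow_succ]

omit [Fintype n] [Fintype n'] [DecidableEq n] [DecidableEq n'] in
/-- Finite sums of block-diagonal matrices. [folklore] -/
lemma sum_fromBlocks_zero {R : Type*} [AddCommMonoid R] {ι : Type*} (s : Finset ι)
    (A : ι → Matrix n n R) (B : ι → Matrix n' n' R) :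
    ∑ i ∈ s, fromBlocks (A i) 0 0 (B i) = fromBlocks (∑ i ∈ s, A i) 0 0 (∑ i ∈ s, B i) := by
  classical
  induction s using Finset.induction_on with
  | empty => simp
  | insert a s ha ih =>
    rw [Finset.sum_insert ha, Finset.sum_insert ha, Finset.sum_insert ha, ih, fromBlocks_add]
    simp

/-- A block-diagonal nilpotent pair exponentiates blockwise: `exp (x diag(A, B)) =
diag(exp (x A), exp (x B))` (characteristic `0`, finite exponential sums). [folklore] -/
lemma exp_smul_fromBlocks [CharZero k] {A : Matrix n n k} {B : Matrix n' n' k} (hA : IsNilpotent A)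
    (hB : IsNilpotent B) (x : k) :
    IsNilpotent.exp (x • fromBlocks A 0 0 B) =
      fromBlocks (IsNilpotent.exp (x • A)) 0 0 (IsNilpotent.exp (x • B)) := by
  obtain ⟨N, hN⟩ := hA
  obtain ⟨N', hN'⟩ := hB
  have hAN : A ^ (N + N') = 0 := by rw [pow_add, hN, zero_mul]
  have hBN : B ^ (N + N') = 0 := by rw [pow_add, hN', mul_zero]
  have hCN : (fromBlocks A 0 0 B) ^ (N + N') = 0 := by
    rw [fromBlocks_zero_pow, hAN, hBN, fromBlocks_zero]
  rw [exp_smul_matrix_eq_sum hCN, exp_smul_matrix_eq_sum hAN, exp_smul_matrix_eq_sum hBN,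
    ← sum_fromBlocks_zero]
  refine Finset.sum_congr rfl fun i _ => ?_
  rw [fromBlocks_zero_pow, fromBlocks_smul, fromBlocks_smul]
  simp

/-- A block-diagonal matrix with nilpotent blocks is nilpotent. [folklore] -/
lemma isNilpotent_fromBlocks_zero {R : Type*} [Semiring R] {A : Matrix n n R} {B : Matrix n' n' R}
    (hA : IsNilpotent A) (hB : IsNilpotent B) : IsNilpotent (fromBlocks A 0 0 B) := by
  obtain ⟨N, hN⟩ := hA
  obtain ⟨N', hN'⟩ := hB
  refine ⟨N + N', ?_⟩
  rw [fromBlocks_zero_pow, pow_add, hN, zero_mul, pow_add, hN', mul_zero, fromBlocks_zero]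

end Matrices

/-! ### The embedding `GL n k × GL n' k →* GL (n ⊕ n') k` -/

section Embedding

/-- **The block-diagonal embedding** `(g, g') ↦ diag(g, g')` of `GL n k × GL n' k` into
`GL (n ⊕ n') k` (the product of the algebraic groups `GL_n`, `GL_{n'}` as a closed subgroup of
`GL_{n+n'}`, Springer 2.1.4). This is the two-block, `Sum`-indexed instance of the Levi embedding
`ParabolicGL.blockDiagonalGL R c` (colouring `c : n ⊕ n' → Bool`, up to the reindexing of the two
fibres with `n`, `n'`); see the module docstring, §"Relation to existing block-diagonal devices".
[folklore] -/
def blockDiagGL : GL n k × GL n' k →* GL (n ⊕ n') k where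
  toFun g :=
    { val := fromBlocks (g.1 : Matrix n n k) 0 0 (g.2 : Matrix n' n' k)
      inv := fromBlocks ((g.1⁻¹ : GL n k) : Matrix n n k) 0 0 ((g.2⁻¹ : GL n' k) : Matrix n' n' k)
      val_inv := by
        rw [fromBlocks_zero_mul_fromBlocks_zero, ← Units.val_mul, ← Units.val_mul, mul_inv_cancel,
          mul_inv_cancel, Units.val_one, Units.val_one, fromBlocks_one]
      inv_val := by
        rw [fromBlocks_zero_mul_fromBlocks_zero, ← Units.val_mul, ← Units.val_mul, inv_mul_cancel,
          inv_mul_cancel, Units.val_one, Units.val_one, fromBlocks_one] }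
  map_one' := Units.ext (by simp)
  map_mul' g h := Units.ext (by simp [fromBlocks_zero_mul_fromBlocks_zero])

/-- The matrix of `blockDiagGL (g, g')`. [folklore] -/
@[simp] lemma coe_blockDiagGL (g : GL n k × GL n' k) :
    ((blockDiagGL g : GL (n ⊕ n') k) : Matrix (n ⊕ n') (n ⊕ n') k) =
      fromBlocks (g.1 : Matrix n n k) 0 0 (g.2 : Matrix n' n' k) :=
  rfl

/-- The matrix of the inverse of `blockDiagGL (g, g')`. [folklore] -/
lemma coe_blockDiagGL_inv (g : GL n k × GL n' k) :
    (((blockDiagGL g)⁻¹ : GL (n ⊕ n') k) : Matrix (n ⊕ n') (n ⊕ n') k) =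
      fromBlocks ((g.1⁻¹ : GL n k) : Matrix n n k) 0 0 ((g.2⁻¹ : GL n' k) : Matrix n' n' k) := by
  rw [← map_inv]
  rfl

/-- `blockDiagGL` is injective. [folklore] -/
theorem blockDiagGL_injective :
    Function.Injective (blockDiagGL : GL n k × GL n' k →* GL (n ⊕ n') k) := by
  intro g h hgh
  have e := congrArg (fun u : GL (n ⊕ n') k => (u : Matrix (n ⊕ n') (n ⊕ n') k)) hgh
  simp only [coe_blockDiagGL, fromBlocks_inj] at e
  exact Prod.ext (Units.ext e.1) (Units.ext e.2.2.2)

/-- The first embedding `g ↦ diag(g, 1)`. [folklore] -/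
def inlBlock : GL n k →* GL (n ⊕ n') k := blockDiagGL.comp (MonoidHom.inl (GL n k) (GL n' k))

/-- The second embedding `g' ↦ diag(1, g')`. [folklore] -/
def inrBlock : GL n' k →* GL (n ⊕ n') k := blockDiagGL.comp (MonoidHom.inr (GL n k) (GL n' k))

/-- Unfolding `inlBlock`. [folklore] -/
lemma inlBlock_apply (g : GL n k) : (inlBlock g : GL (n ⊕ n') k) = blockDiagGL (g, (1 : GL n' k)) :=
  rfl

/-- Unfolding `inrBlock`. [folklore] -/
lemma inrBlock_apply (g' : GL n' k) : (inrBlock g' : GL (n ⊕ n') k) = blockDiagGL ((1 : GL n k), g') :=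
  rfl

/-- `diag(g, g') = diag(g, 1) · diag(1, g')`. [folklore] -/
lemma blockDiagGL_eq_inl_mul_inr (g : GL n k) (g' : GL n' k) :
    blockDiagGL (g, g') = inlBlock g * (inrBlock g' : GL (n ⊕ n') k) := by
  rw [inlBlock_apply, inrBlock_apply, ← map_mul, Prod.mk_mul_mk, mul_one, one_mul]

/-- The two embeddings commute. [folklore] -/
lemma inlBlock_mul_inrBlock_comm (g : GL n k) (g' : GL n' k) :
    inlBlock g * (inrBlock g' : GL (n ⊕ n') k) = inrBlock g' * inlBlock g := by
  rw [inlBlock_apply, inrBlock_apply, ← map_mul, ← map_mul, Prod.mk_mul_mk, Prod.mk_mul_mk,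
    mul_one, one_mul, mul_one, one_mul]

/-- **Conjugation by a block-diagonal element acts blockwise** on block-diagonal matrices:
`diag(g, g') · diag(A, A') · diag(g, g')⁻¹ = diag(g A g⁻¹, g' A' g'⁻¹)` (the adjoint action of
`G × G'` on `𝔤𝔩_n ⊕ 𝔤𝔩_{n'}`). [folklore] -/
theorem blockDiagGL_conj_fromBlocks (g : GL n k × GL n' k) (A : Matrix n n k) (A' : Matrix n' n' k) :
    ((blockDiagGL g : GL (n ⊕ n') k) : Matrix (n ⊕ n') (n ⊕ n') k) * fromBlocks A 0 0 A' *
        (((blockDiagGL g)⁻¹ : GL (n ⊕ n') k) : Matrix (n ⊕ n') (n ⊕ n') k) =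
      fromBlocks ((g.1 : Matrix n n k) * A * ((g.1⁻¹ : GL n k) : Matrix n n k)) 0 0
        ((g.2 : Matrix n' n' k) * A' * ((g.2⁻¹ : GL n' k) : Matrix n' n' k)) := by
  rw [coe_blockDiagGL, coe_blockDiagGL_inv, fromBlocks_zero_mul_fromBlocks_zero,
    fromBlocks_zero_mul_fromBlocks_zero]

/-- The exponential one-parameter group of a block-diagonal nilpotent matrix is the block
diagonal of the exponential groups of the blocks. [folklore] -/
theorem expHom_fromBlocks [CharZero k] {A : Matrix n n k} {B : Matrix n' n' k} (hA : IsNilpotent A)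
    (hB : IsNilpotent B) (x : Multiplicative k) :
    expHom (fromBlocks A 0 0 B) (isNilpotent_fromBlocks_zero hA hB) x =
      blockDiagGL (expHom A hA x, expHom B hB x) := by
  apply Units.ext
  rw [coe_expHom_apply, coe_blockDiagGL, coe_expHom_apply, coe_expHom_apply]
  exact exp_smul_fromBlocks hA hB _

end Embedding

/-! ### The range and the block projections -/

section Range

/-- The subgroup of block-diagonal elements of `GL (n ⊕ n') k` (the image of `GL_n × GL_{n'}`);
by `mem_blockDiagRange_iff` these are the invertible matrices with vanishing off-diagonal blocks,
i.e. the two-block (`j : Bool`) instance of `ChevalleyGroupBasic.blockDiagSubgroup` up to the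
reindexing `(Σ j : Bool, _) ≃ n ⊕ n'` (see the module docstring). [folklore] -/
def blockDiagRange (n n' : Type*) (k : Type*) [Field k] [Fintype n] [DecidableEq n] [Fintype n']
    [DecidableEq n'] : Subgroup (GL (n ⊕ n') k) :=
  (blockDiagGL : GL n k × GL n' k →* GL (n ⊕ n') k).range

/-- `blockDiagGL g` lies in the range. [folklore] -/
lemma blockDiagGL_mem_blockDiagRange (g : GL n k × GL n' k) : blockDiagGL g ∈ blockDiagRange n n' k :=
  ⟨g, rfl⟩

/-- For a block matrix with vanishing off-diagonal blocks, an inverse is block diagonal with the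
blockwise inverses: the blocks of an invertible block-diagonal matrix are invertible. [folklore] -/
lemma toBlocks₁₁_mul_toBlocks₁₁_of_offDiag_eq_zero {g : GL (n ⊕ n') k}
    (h₁₂ : (g : Matrix (n ⊕ n') (n ⊕ n') k).toBlocks₁₂ = 0)
    (h₂₁ : (g : Matrix (n ⊕ n') (n ⊕ n') k).toBlocks₂₁ = 0) :
    (g : Matrix (n ⊕ n') (n ⊕ n') k).toBlocks₁₁ * ((g⁻¹ : GL (n ⊕ n') k) : Matrix (n ⊕ n') (n ⊕ n') k).toBlocks₁₁ = 1 ∧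
      ((g⁻¹ : GL (n ⊕ n') k) : Matrix (n ⊕ n') (n ⊕ n') k).toBlocks₁₁ * (g : Matrix (n ⊕ n') (n ⊕ n') k).toBlocks₁₁ = 1 ∧
      (g : Matrix (n ⊕ n') (n ⊕ n') k).toBlocks₂₂ * ((g⁻¹ : GL (n ⊕ n') k) : Matrix (n ⊕ n') (n ⊕ n') k).toBlocks₂₂ = 1 ∧
      ((g⁻¹ : GL (n ⊕ n') k) : Matrix (n ⊕ n') (n ⊕ n') k).toBlocks₂₂ * (g : Matrix (n ⊕ n') (n ⊕ n') k).toBlocks₂₂ = 1 := by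
  set M : Matrix (n ⊕ n') (n ⊕ n') k := ((g : GL (n ⊕ n') k) : Matrix (n ⊕ n') (n ⊕ n') k) with hM
  set M' : Matrix (n ⊕ n') (n ⊕ n') k := ((g⁻¹ : GL (n ⊕ n') k) : Matrix (n ⊕ n') (n ⊕ n') k) with hM'
  have hMM' : M * M' = 1 := by rw [hM, hM', ← Units.val_mul, mul_inv_cancel, Units.val_one]
  have hM'M : M' * M = 1 := by rw [hM, hM', ← Units.val_mul, inv_mul_cancel, Units.val_one]
  have eM : M = fromBlocks M.toBlocks₁₁ 0 0 M.toBlocks₂₂ := by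
    conv_lhs => rw [← fromBlocks_toBlocks M]
    rw [h₁₂, h₂₁]
  have eM' : M' = fromBlocks M'.toBlocks₁₁ M'.toBlocks₁₂ M'.toBlocks₂₁ M'.toBlocks₂₂ :=
    (fromBlocks_toBlocks M').symm
  have e1 := hMM'
  rw [eM, eM', fromBlocks_multiply, ← fromBlocks_one, fromBlocks_inj] at e1
  have e2 := hM'M
  rw [eM, eM', fromBlocks_multiply, ← fromBlocks_one, fromBlocks_inj] at e2
  simp only [Matrix.zero_mul, Matrix.mul_zero, add_zero, zero_add] at e1 e2
  exact ⟨e1.1, e2.1, e1.2.2.2, e2.2.2.2⟩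

/-- **Membership in the block-diagonal subgroup**: an invertible matrix is block diagonal iff
its off-diagonal blocks vanish. [folklore] -/
theorem mem_blockDiagRange_iff {g : GL (n ⊕ n') k} :
    g ∈ blockDiagRange n n' k ↔
      (g : Matrix (n ⊕ n') (n ⊕ n') k).toBlocks₁₂ = 0 ∧ (g : Matrix (n ⊕ n') (n ⊕ n') k).toBlocks₂₁ = 0 := by
  constructor
  · rintro ⟨h, rfl⟩
    simp
  · rintro ⟨h₁₂, h₂₁⟩
    obtain ⟨e1, e2, e3, e4⟩ := toBlocks₁₁_mul_toBlocks₁₁_of_offDiag_eq_zero h₁₂ h₂₁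
    let a : GL n k := ⟨_, _, e1, e2⟩
    let b : GL n' k := ⟨_, _, e3, e4⟩
    refine ⟨(a, b), Units.ext ?_⟩
    change fromBlocks (g : Matrix (n ⊕ n') (n ⊕ n') k).toBlocks₁₁ 0 0
      (g : Matrix (n ⊕ n') (n ⊕ n') k).toBlocks₂₂ = _
    conv_rhs => rw [← fromBlocks_toBlocks (g : Matrix (n ⊕ n') (n ⊕ n') k)]
    rw [h₁₂, h₂₁]

/-- The isomorphism `GL n k × GL n' k ≃* blockDiagRange` onto the range. [folklore] -/
def blockDiagEquiv : GL n k × GL n' k ≃* ↥(blockDiagRange n n' k) :=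
  MonoidHom.ofInjective blockDiagGL_injective

/-- Unfolding `blockDiagEquiv`. [folklore] -/
@[simp] lemma coe_blockDiagEquiv (g : GL n k × GL n' k) :
    ((blockDiagEquiv g : ↥(blockDiagRange n n' k)) : GL (n ⊕ n') k) = blockDiagGL g :=
  MonoidHom.ofInjective_apply blockDiagGL_injective

/-- The inverse of `blockDiagEquiv` recovers the element. [folklore] -/
@[simp] lemma blockDiagGL_blockDiagEquiv_symm (g : ↥(blockDiagRange n n' k)) :
    blockDiagGL ((blockDiagEquiv (n := n) (n' := n') (k := k)).symm g) = (g : GL (n ⊕ n') k) :=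
  MonoidHom.apply_ofInjective_symm blockDiagGL_injective g

/-- **The first block** of a block-diagonal element, as a homomorphism `blockDiagRange → GL n k`
(the projection `G × G' → G`); the two-block counterpart of the Levi projection
`ParabolicGL.leviProjection R c · a` (which is defined on the whole standard parabolic).
[folklore] -/
def fstBlockGL : ↥(blockDiagRange n n' k) →* GL n k :=
  (MonoidHom.fst (GL n k) (GL n' k)).comp (blockDiagEquiv (n := n) (n' := n') (k := k)).symm.toMonoidHom

/-- **The second block** of a block-diagonal element, as a homomorphism `blockDiagRange → GL n' k`
(the projection `G × G' → G'`); two-block counterpart of `ParabolicGL.leviProjection`.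
[folklore] -/
def sndBlockGL : ↥(blockDiagRange n n' k) →* GL n' k :=
  (MonoidHom.snd (GL n k) (GL n' k)).comp (blockDiagEquiv (n := n) (n' := n') (k := k)).symm.toMonoidHom

/-- A block-diagonal element is the block diagonal of its two blocks. [folklore] -/
theorem blockDiagGL_fstBlockGL_sndBlockGL (g : ↥(blockDiagRange n n' k)) :
    blockDiagGL (fstBlockGL g, sndBlockGL g) = (g : GL (n ⊕ n') k) := by
  rw [← blockDiagGL_blockDiagEquiv_symm g]
  rfl

/-- The first block of `diag(a, b)` is `a`. [folklore] -/
@[simp] theorem fstBlockGL_mk (g : GL n k × GL n' k) (h : blockDiagGL g ∈ blockDiagRange n n' k) :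
    fstBlockGL ⟨blockDiagGL g, h⟩ = g.1 := by
  have e : (⟨blockDiagGL g, h⟩ : ↥(blockDiagRange n n' k)) = blockDiagEquiv g :=
    Subtype.ext (coe_blockDiagEquiv g).symm
  rw [e]
  simp [fstBlockGL]

/-- The second block of `diag(a, b)` is `b`. [folklore] -/
@[simp] theorem sndBlockGL_mk (g : GL n k × GL n' k) (h : blockDiagGL g ∈ blockDiagRange n n' k) :
    sndBlockGL ⟨blockDiagGL g, h⟩ = g.2 := by
  have e : (⟨blockDiagGL g, h⟩ : ↥(blockDiagRange n n' k)) = blockDiagEquiv g :=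
    Subtype.ext (coe_blockDiagEquiv g).symm
  rw [e]
  simp [sndBlockGL]

/-- The matrix of the first block is the `₁₁`-block of the matrix. [folklore] -/
theorem coe_fstBlockGL (g : ↥(blockDiagRange n n' k)) :
    ((fstBlockGL g : GL n k) : Matrix n n k) = ((g : GL (n ⊕ n') k) : Matrix (n ⊕ n') (n ⊕ n') k).toBlocks₁₁ := by
  conv_rhs => rw [← blockDiagGL_fstBlockGL_sndBlockGL g]
  simp

/-- The matrix of the second block is the `₂₂`-block of the matrix. [folklore] -/
theorem coe_sndBlockGL (g : ↥(blockDiagRange n n' k)) :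
    ((sndBlockGL g : GL n' k) : Matrix n' n' k) = ((g : GL (n ⊕ n') k) : Matrix (n ⊕ n') (n ⊕ n') k).toBlocks₂₂ := by
  conv_rhs => rw [← blockDiagGL_fstBlockGL_sndBlockGL g]
  simp

/-- Two block-diagonal elements with the same blocks are equal. [folklore] -/
theorem blockDiagRange_ext {g h : ↥(blockDiagRange n n' k)} (h1 : fstBlockGL g = fstBlockGL h)
    (h2 : sndBlockGL g = sndBlockGL h) : g = h := by
  apply Subtype.ext
  rw [← blockDiagGL_fstBlockGL_sndBlockGL g, ← blockDiagGL_fstBlockGL_sndBlockGL h, h1, h2]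

end Range

/-! ### The product of two subgroups -/

section Prod

variable (G : Subgroup (GL n k)) (G' : Subgroup (GL n' k))

/-- **The product subgroup `G × G'`** realised by block-diagonal matrices in `GL (n ⊕ n') k`.
[folklore] -/
def prodBlock : Subgroup (GL (n ⊕ n') k) := (G.prod G').map blockDiagGL

variable {G G'}

/-- Membership in `prodBlock G G'`. [folklore] -/
theorem mem_prodBlock_iff {x : GL (n ⊕ n') k} :
    x ∈ prodBlock G G' ↔ ∃ g ∈ G, ∃ g' ∈ G', blockDiagGL (g, g') = x := by
  simp only [prodBlock, Subgroup.mem_map, Subgroup.mem_prod, Prod.exists]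
  constructor
  · rintro ⟨g, g', ⟨hg, hg'⟩, rfl⟩; exact ⟨g, hg, g', hg', rfl⟩
  · rintro ⟨g, hg, g', hg', rfl⟩; exact ⟨g, g', ⟨hg, hg'⟩, rfl⟩

/-- `diag(g, g') ∈ G × G'` for `g ∈ G`, `g' ∈ G'`. [folklore] -/
theorem blockDiagGL_mem_prodBlock {g : GL n k} {g' : GL n' k} (hg : g ∈ G) (hg' : g' ∈ G') :
    blockDiagGL (g, g') ∈ prodBlock G G' :=
  mem_prodBlock_iff.2 ⟨g, hg, g', hg', rfl⟩

/-- `diag(g, g') ∈ G × G'` iff `g ∈ G` and `g' ∈ G'`. [folklore] -/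
theorem blockDiagGL_mem_prodBlock_iff {g : GL n k} {g' : GL n' k} :
    blockDiagGL (g, g') ∈ prodBlock G G' ↔ g ∈ G ∧ g' ∈ G' := by
  rw [mem_prodBlock_iff]
  constructor
  · rintro ⟨a, ha, b, hb, e⟩
    have e' := blockDiagGL_injective e
    simp only [Prod.mk.injEq] at e'
    exact ⟨e'.1 ▸ ha, e'.2 ▸ hb⟩
  · rintro ⟨hg, hg'⟩; exact ⟨g, hg, g', hg', rfl⟩

/-- `G × G'` consists of block-diagonal elements. [folklore] -/
theorem prodBlock_le_blockDiagRange : prodBlock G G' ≤ blockDiagRange n n' k := by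
  rintro x hx
  obtain ⟨g, -, g', -, rfl⟩ := mem_prodBlock_iff.1 hx
  exact blockDiagGL_mem_blockDiagRange _

/-- The blocks of an element of `G × G'` lie in `G`, resp. `G'`. [folklore] -/
theorem fstBlockGL_mem_of_mem_prodBlock {x : GL (n ⊕ n') k} (hx : x ∈ prodBlock G G') :
    fstBlockGL ⟨x, prodBlock_le_blockDiagRange hx⟩ ∈ G ∧
      sndBlockGL ⟨x, prodBlock_le_blockDiagRange hx⟩ ∈ G' := by
  obtain ⟨g, hg, g', hg', rfl⟩ := mem_prodBlock_iff.1 hx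
  simp [hg, hg']

/-- `prodBlock` is monotone. [folklore] -/
theorem prodBlock_mono {H : Subgroup (GL n k)} {H' : Subgroup (GL n' k)} (h : G ≤ H) (h' : G' ≤ H') :
    prodBlock G G' ≤ prodBlock H H' := fun _ hx => by
  obtain ⟨g, hg, g', hg', rfl⟩ := mem_prodBlock_iff.1 hx
  exact blockDiagGL_mem_prodBlock (h hg) (h' hg')

/-- The first embedding lands in `G × G'` iff the argument lies in `G`. [folklore] -/
theorem inlBlock_mem_prodBlock_iff {g : GL n k} : inlBlock g ∈ prodBlock G G' ↔ g ∈ G := by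
  rw [inlBlock_apply, blockDiagGL_mem_prodBlock_iff]
  simp [G'.one_mem]

/-- The second embedding lands in `G × G'` iff the argument lies in `G'`. [folklore] -/
theorem inrBlock_mem_prodBlock_iff {g' : GL n' k} : inrBlock g' ∈ prodBlock G G' ↔ g' ∈ G' := by
  rw [inrBlock_apply, blockDiagGL_mem_prodBlock_iff]
  simp [G.one_mem]

end Prod

/-! ### Coordinates of the blocks as polynomials in the coordinates of the big matrix -/

section Coords

variable (n n' k)

/-- The generic `₂₂`-block `(X_{inr i, inr j})` of the generic matrix of `GL (n ⊕ n')`. [folklore] -/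
def genericBlock₂₂ : Matrix n' n' (MvPolynomial (GLCoord (n ⊕ n')) k) :=
  Matrix.of fun i j => MvPolynomial.X (Sum.inl (Sum.inr i, Sum.inr j))

/-- The generic `₁₁`-block `(X_{inl i, inl j})` of the generic matrix of `GL (n ⊕ n')`. [folklore] -/
def genericBlock₁₁ : Matrix n n (MvPolynomial (GLCoord (n ⊕ n')) k) :=
  Matrix.of fun i j => MvPolynomial.X (Sum.inl (Sum.inl i, Sum.inl j))

/-- **The coordinates of the first block as polynomials in the coordinates of the big matrix**:
`x_{ij} ↦ x_{inl i, inl j}` and `det⁻¹ ↦ det⁻¹ · det (x_{inr ·, inr ·})` — on block-diagonal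
matrices `det(g)⁻¹ = det(diag(g, g'))⁻¹ det(g')`. [folklore] -/
def fstCoordPoly : GLCoord n → MvPolynomial (GLCoord (n ⊕ n')) k
  | Sum.inl ij => MvPolynomial.X (Sum.inl (Sum.inl ij.1, Sum.inl ij.2))
  | Sum.inr _ => MvPolynomial.X (Sum.inr ()) * (genericBlock₂₂ k n n').det

/-- **The coordinates of the second block as polynomials in the coordinates of the big matrix.**
[folklore] -/
def sndCoordPoly : GLCoord n' → MvPolynomial (GLCoord (n ⊕ n')) k
  | Sum.inl ij => MvPolynomial.X (Sum.inl (Sum.inr ij.1, Sum.inr ij.2))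
  | Sum.inr _ => MvPolynomial.X (Sum.inr ()) * (genericBlock₁₁ k n n').det

variable {n n' k}

/-- Evaluating the generic `₂₂`-block at the coordinates of `x` gives the `₂₂`-block of `x`.
[folklore] -/
lemma eval_genericBlock₂₂ (x : GL (n ⊕ n') k) :
    (MvPolynomial.eval (glCoordFun x)).mapMatrix (genericBlock₂₂ k n n') =
      (x : Matrix (n ⊕ n') (n ⊕ n') k).toBlocks₂₂ := by
  ext i j; simp [genericBlock₂₂, Matrix.toBlocks₂₂]

/-- Evaluating the generic `₁₁`-block at the coordinates of `x` gives the `₁₁`-block of `x`.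
[folklore] -/
lemma eval_genericBlock₁₁ (x : GL (n ⊕ n') k) :
    (MvPolynomial.eval (glCoordFun x)).mapMatrix (genericBlock₁₁ k n n') =
      (x : Matrix (n ⊕ n') (n ⊕ n') k).toBlocks₁₁ := by
  ext i j; simp [genericBlock₁₁, Matrix.toBlocks₁₁]

/-- **Evaluation of `fstCoordPoly` at a block-diagonal element `diag(g, g')`** gives the
coordinates of `g`. [folklore] -/
theorem eval_fstCoordPoly (g : GL n k) (g' : GL n' k) (c : GLCoord n) :
    MvPolynomial.eval (glCoordFun (blockDiagGL (g, g') : GL (n ⊕ n') k)) (fstCoordPoly k n n' c) =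
      glCoordFun g c := by
  rcases c with ⟨i, j⟩ | ⟨⟩
  · simp [fstCoordPoly]
  · simp only [fstCoordPoly, map_mul, MvPolynomial.eval_X, glCoordFun_inr]
    rw [RingHom.map_det, eval_genericBlock₂₂]
    simp only [coe_blockDiagGL, toBlocks_fromBlocks₂₂, det_fromBlocks_zero₂₁]
    have hb : ((g' : GL n' k) : Matrix n' n' k).det ≠ 0 :=
      (Matrix.isUnit_iff_isUnit_det _ |>.mp (Units.isUnit g')).ne_zero
    field_simp

/-- **Evaluation of `sndCoordPoly` at a block-diagonal element `diag(g, g')`** gives the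
coordinates of `g'`. [folklore] -/
theorem eval_sndCoordPoly (g : GL n k) (g' : GL n' k) (c : GLCoord n') :
    MvPolynomial.eval (glCoordFun (blockDiagGL (g, g') : GL (n ⊕ n') k)) (sndCoordPoly k n n' c) =
      glCoordFun g' c := by
  rcases c with ⟨i, j⟩ | ⟨⟩
  · simp [sndCoordPoly]
  · simp only [sndCoordPoly, map_mul, MvPolynomial.eval_X, glCoordFun_inr]
    rw [RingHom.map_det, eval_genericBlock₁₁]
    simp only [coe_blockDiagGL, toBlocks_fromBlocks₁₁, det_fromBlocks_zero₂₁]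
    have ha : ((g : GL n k) : Matrix n n k).det ≠ 0 :=
      (Matrix.isUnit_iff_isUnit_det _ |>.mp (Units.isUnit g)).ne_zero
    field_simp

/-- Evaluation of `fstCoordPoly` at an element of the block-diagonal subgroup. [folklore] -/
theorem eval_fstCoordPoly_of_mem (x : ↥(blockDiagRange n n' k)) (c : GLCoord n) :
    MvPolynomial.eval (glCoordFun (x : GL (n ⊕ n') k)) (fstCoordPoly k n n' c) =
      glCoordFun (fstBlockGL x) c := by
  conv_lhs => rw [← blockDiagGL_fstBlockGL_sndBlockGL x]
  exact eval_fstCoordPoly _ _ c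

/-- Evaluation of `sndCoordPoly` at an element of the block-diagonal subgroup. [folklore] -/
theorem eval_sndCoordPoly_of_mem (x : ↥(blockDiagRange n n' k)) (c : GLCoord n') :
    MvPolynomial.eval (glCoordFun (x : GL (n ⊕ n') k)) (sndCoordPoly k n n' c) =
      glCoordFun (sndBlockGL x) c := by
  conv_lhs => rw [← blockDiagGL_fstBlockGL_sndBlockGL x]
  exact eval_sndCoordPoly _ _ c

/-- Substituting `fstCoordPoly` into a polynomial `p` in the coordinates of `GL n` and
evaluating at `diag(g, g')` evaluates `p` at `g`. [folklore] -/
theorem eval_aeval_fstCoordPoly (g : GL n k) (g' : GL n' k) (p : MvPolynomial (GLCoord n) k) :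
    MvPolynomial.eval (glCoordFun (blockDiagGL (g, g') : GL (n ⊕ n') k))
        (MvPolynomial.aeval (fstCoordPoly k n n') p) =
      MvPolynomial.eval (glCoordFun g) p := by
  rw [show MvPolynomial.aeval (fstCoordPoly k n n') p = MvPolynomial.bind₁ (fstCoordPoly k n n') p
    from rfl, eval_bind₁]
  have e : (fun c => MvPolynomial.eval (glCoordFun (blockDiagGL (g, g') : GL (n ⊕ n') k))
      (fstCoordPoly k n n' c)) = glCoordFun g := funext (eval_fstCoordPoly g g')
  rw [e]

/-- Substituting `sndCoordPoly` into a polynomial `p` in the coordinates of `GL n'` and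
evaluating at `diag(g, g')` evaluates `p` at `g'`. [folklore] -/
theorem eval_aeval_sndCoordPoly (g : GL n k) (g' : GL n' k) (p : MvPolynomial (GLCoord n') k) :
    MvPolynomial.eval (glCoordFun (blockDiagGL (g, g') : GL (n ⊕ n') k))
        (MvPolynomial.aeval (sndCoordPoly k n n') p) =
      MvPolynomial.eval (glCoordFun g') p := by
  rw [show MvPolynomial.aeval (sndCoordPoly k n n') p = MvPolynomial.bind₁ (sndCoordPoly k n n') p
    from rfl, eval_bind₁]
  have e : (fun c => MvPolynomial.eval (glCoordFun (blockDiagGL (g, g') : GL (n ⊕ n') k))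
      (sndCoordPoly k n n' c)) = glCoordFun g' := funext (eval_sndCoordPoly g g')
  rw [e]

/-! ### Algebraicity of the product and of the projections -/

/-- The polynomials cutting out the block-diagonal matrices: the off-diagonal coordinates.
[folklore] -/
def offDiagPolys (n n' k : Type*) [Field k] : Set (MvPolynomial (GLCoord (n ⊕ n')) k) :=
  Set.range (fun ij : n × n' => MvPolynomial.X (Sum.inl (Sum.inl ij.1, Sum.inr ij.2))) ∪
    Set.range (fun ij : n' × n => MvPolynomial.X (Sum.inl (Sum.inr ij.1, Sum.inl ij.2)))

/-- An element of `GL (n ⊕ n')` killed by the off-diagonal coordinates is block diagonal.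
[folklore] -/
lemma mem_blockDiagRange_of_forall_offDiag {x : GL (n ⊕ n') k}
    (hx : ∀ p ∈ offDiagPolys n n' k, MvPolynomial.eval (glCoordFun x) p = 0) :
    x ∈ blockDiagRange n n' k := by
  rw [mem_blockDiagRange_iff]
  constructor
  · ext i j
    have := hx _ (Or.inl ⟨(i, j), rfl⟩)
    simpa [Matrix.toBlocks₁₂] using this
  · ext i j
    have := hx _ (Or.inr ⟨(i, j), rfl⟩)
    simpa [Matrix.toBlocks₂₁] using this

/-- Block-diagonal elements are killed by the off-diagonal coordinates. [folklore] -/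
lemma eval_offDiag_eq_zero (g : GL n k × GL n' k) {p : MvPolynomial (GLCoord (n ⊕ n')) k}
    (hp : p ∈ offDiagPolys n n' k) : MvPolynomial.eval (glCoordFun (blockDiagGL g)) p = 0 := by
  rcases hp with ⟨ij, rfl⟩ | ⟨ij, rfl⟩ <;> simp

/-- **`G × G'` is an algebraic subgroup of `GL (n ⊕ n')` when `G ≤ GL n` and `G' ≤ GL n'`
are algebraic**: it is cut out by the off-diagonal coordinates and by the equations of `G`
(resp. `G'`) in the coordinates of the first (second) block (Springer 1.1, 2.1.4: products of
closed sets are closed). [folklore] -/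
theorem isAlgebraicSubgroup_prodBlock {G : Subgroup (GL n k)} {G' : Subgroup (GL n' k)}
    (hG : IsAlgebraicSubgroup G) (hG' : IsAlgebraicSubgroup G') : IsAlgebraicSubgroup (prodBlock G G') := by
  obtain ⟨S, hS⟩ := hG
  obtain ⟨S', hS'⟩ := hG'
  refine ⟨offDiagPolys n n' k ∪ (MvPolynomial.aeval (fstCoordPoly k n n') '' S ∪
    MvPolynomial.aeval (sndCoordPoly k n n') '' S'), Set.ext fun x => ?_⟩
  constructor
  · intro hx
    obtain ⟨g, hg, g', hg', rfl⟩ := mem_prodBlock_iff.1 hx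
    have hgS : ∀ p ∈ S, MvPolynomial.eval (glCoordFun g) p = 0 := by
      have : (g : GL n k) ∈ zeroLocusGL S := by rw [← hS]; exact hg
      exact this
    have hgS' : ∀ p ∈ S', MvPolynomial.eval (glCoordFun g') p = 0 := by
      have : (g' : GL n' k) ∈ zeroLocusGL S' := by rw [← hS']; exact hg'
      exact this
    rintro p (hp | ⟨q, hq, rfl⟩ | ⟨q, hq, rfl⟩)
    · exact eval_offDiag_eq_zero _ hp
    · rw [eval_aeval_fstCoordPoly]; exact hgS q hq
    · rw [eval_aeval_sndCoordPoly]; exact hgS' q hq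
  · intro hx
    have hx' : ∀ p ∈ offDiagPolys n n' k, MvPolynomial.eval (glCoordFun x) p = 0 :=
      fun p hp => hx p (Or.inl hp)
    have hmem := mem_blockDiagRange_of_forall_offDiag hx'
    obtain ⟨⟨g, g'⟩, rfl⟩ := hmem
    refine blockDiagGL_mem_prodBlock ?_ ?_
    · have : (g : GL n k) ∈ zeroLocusGL S := fun p hp => by
        rw [← eval_aeval_fstCoordPoly g g' p]
        exact hx _ (Or.inr (Or.inl ⟨p, hp, rfl⟩))
      rwa [← hS] at this
    · have : (g' : GL n' k) ∈ zeroLocusGL S' := fun p hp => by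
        rw [← eval_aeval_sndCoordPoly g g' p]
        exact hx _ (Or.inr (Or.inr ⟨p, hp, rfl⟩))
      rwa [← hS'] at this

/-- The block-diagonal subgroup is `GL_n × GL_{n'}`, hence algebraic. [folklore] -/
theorem blockDiagRange_eq_prodBlock_top : blockDiagRange n n' k = prodBlock (⊤ : Subgroup (GL n k)) ⊤ := by
  ext x
  constructor
  · rintro ⟨⟨g, g'⟩, rfl⟩; exact blockDiagGL_mem_prodBlock trivial trivial
  · exact fun hx => prodBlock_le_blockDiagRange hx

/-- The block-diagonal subgroup is algebraic. [folklore] -/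
theorem isAlgebraicSubgroup_blockDiagRange : IsAlgebraicSubgroup (blockDiagRange n n' k) := by
  rw [blockDiagRange_eq_prodBlock_top]
  exact isAlgebraicSubgroup_prodBlock isAlgebraicSubgroup_top isAlgebraicSubgroup_top

/-- The range of the first embedding is `G × 1` for `G = GL_n`, hence algebraic; more generally
`inlBlock '' G = G × 1`. [folklore] -/
theorem map_inlBlock_eq_prodBlock (G : Subgroup (GL n k)) : G.map inlBlock = prodBlock G (⊥ : Subgroup (GL n' k)) := by
  ext x
  simp only [Subgroup.mem_map, mem_prodBlock_iff, Subgroup.mem_bot]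
  constructor
  · rintro ⟨g, hg, rfl⟩; exact ⟨g, hg, 1, rfl, rfl⟩
  · rintro ⟨g, hg, g', rfl, rfl⟩; exact ⟨g, hg, rfl⟩

/-- `inrBlock '' G' = 1 × G'`. [folklore] -/
theorem map_inrBlock_eq_prodBlock (G' : Subgroup (GL n' k)) : G'.map inrBlock = prodBlock (⊥ : Subgroup (GL n k)) G' := by
  ext x
  simp only [Subgroup.mem_map, mem_prodBlock_iff, Subgroup.mem_bot]
  constructor
  · rintro ⟨g', hg', rfl⟩; exact ⟨1, rfl, g', hg', rfl⟩
  · rintro ⟨g, rfl, g', hg', rfl⟩; exact ⟨g', hg', rfl⟩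

/-- `G × 1` is algebraic for algebraic `G`. [folklore] -/
theorem isAlgebraicSubgroup_map_inlBlock {G : Subgroup (GL n k)} (hG : IsAlgebraicSubgroup G) :
    IsAlgebraicSubgroup (G.map (inlBlock : GL n k →* GL (n ⊕ n') k)) := by
  rw [map_inlBlock_eq_prodBlock]
  exact isAlgebraicSubgroup_prodBlock hG isAlgebraicSubgroup_bot

/-- `1 × G'` is algebraic for algebraic `G'`. [folklore] -/
theorem isAlgebraicSubgroup_map_inrBlock {G' : Subgroup (GL n' k)} (hG' : IsAlgebraicSubgroup G') :
    IsAlgebraicSubgroup (G'.map (inrBlock : GL n' k →* GL (n ⊕ n') k)) := by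
  rw [map_inrBlock_eq_prodBlock]
  exact isAlgebraicSubgroup_prodBlock isAlgebraicSubgroup_bot hG'

/-- **The first block projection of a subgroup of block-diagonal elements is an algebraic
homomorphism** (its coordinates are the polynomials `fstCoordPoly`). [folklore] -/
theorem isAlgebraicGL_fstBlockGL_comp {H : Subgroup (GL (n ⊕ n') k)} (hH : H ≤ blockDiagRange n n' k) :
    MonoidHom.IsAlgebraicGL (fstBlockGL.comp (Subgroup.inclusion hH)) :=
  ⟨fstCoordPoly k n n', fun g c => by
    rw [MonoidHom.comp_apply, ← eval_fstCoordPoly_of_mem]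
    rfl⟩

/-- **The second block projection of a subgroup of block-diagonal elements is an algebraic
homomorphism.** [folklore] -/
theorem isAlgebraicGL_sndBlockGL_comp {H : Subgroup (GL (n ⊕ n') k)} (hH : H ≤ blockDiagRange n n' k) :
    MonoidHom.IsAlgebraicGL (sndBlockGL.comp (Subgroup.inclusion hH)) :=
  ⟨sndCoordPoly k n n', fun g c => by
    rw [MonoidHom.comp_apply, ← eval_sndCoordPoly_of_mem]
    rfl⟩

/-- The polynomials giving the coordinates of `diag(g, 1)` in terms of those of `g`. [folklore] -/
def inlCoordPoly : GLCoord (n ⊕ n') → MvPolynomial (GLCoord n) k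
  | Sum.inl (Sum.inl i, Sum.inl j) => MvPolynomial.X (Sum.inl (i, j))
  | Sum.inl (Sum.inl _, Sum.inr _) => 0
  | Sum.inl (Sum.inr _, Sum.inl _) => 0
  | Sum.inl (Sum.inr i, Sum.inr j) => MvPolynomial.C ((1 : Matrix n' n' k) i j)
  | Sum.inr _ => MvPolynomial.X (Sum.inr ())

/-- The polynomials giving the coordinates of `diag(1, g')` in terms of those of `g'`. [folklore] -/
def inrCoordPoly : GLCoord (n ⊕ n') → MvPolynomial (GLCoord n') k
  | Sum.inl (Sum.inl i, Sum.inl j) => MvPolynomial.C ((1 : Matrix n n k) i j)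
  | Sum.inl (Sum.inl _, Sum.inr _) => 0
  | Sum.inl (Sum.inr _, Sum.inl _) => 0
  | Sum.inl (Sum.inr i, Sum.inr j) => MvPolynomial.X (Sum.inl (i, j))
  | Sum.inr _ => MvPolynomial.X (Sum.inr ())

/-- **The first embedding `G → GL (n ⊕ n')`, `g ↦ diag(g, 1)`, is an algebraic homomorphism.**
[folklore] -/
theorem isAlgebraicGL_inlBlock (G : Subgroup (GL n k)) :
    MonoidHom.IsAlgebraicGL ((inlBlock : GL n k →* GL (n ⊕ n') k).comp G.subtype) := by
  refine ⟨inlCoordPoly, fun g c => ?_⟩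
  rcases c with ⟨i | i, j | j⟩ | ⟨⟩ <;>
    simp [inlCoordPoly, inlBlock_apply]

/-- **The second embedding `G' → GL (n ⊕ n')`, `g' ↦ diag(1, g')`, is an algebraic
homomorphism.** [folklore] -/
theorem isAlgebraicGL_inrBlock (G' : Subgroup (GL n' k)) :
    MonoidHom.IsAlgebraicGL ((inrBlock : GL n' k →* GL (n ⊕ n') k).comp G'.subtype) := by
  refine ⟨inrCoordPoly, fun g c => ?_⟩
  rcases c with ⟨i | i, j | j⟩ | ⟨⟩ <;>
    simp [inrCoordPoly, inrBlock_apply, det_fromBlocks_zero₂₁]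

end Coords

/-! ### The Lie algebra of a product: `Lie(G × G') ⊆ Lie(G) ⊕ Lie(G')` -/

section Lie

/-- **The `k[ε]`-point `1 + ε Ã` of `GL (n ⊕ n')` restricts, through `fstCoordPoly`, to the
`k[ε]`-point `1 + ε Ã₁₁` of `GL n`**: on the entry coordinates this is clear, and on `det⁻¹`
it is the identity `(1 - ε tr Ã)(1 + ε tr Ã₂₂) = 1 - ε tr Ã₁₁` (`det (1 + ε B) = 1 + ε tr B`,
`det_dualMatrix`). [folklore] -/
theorem aeval_dualPoint_fstCoordPoly (A : Matrix (n ⊕ n') (n ⊕ n') k) (c : GLCoord n) :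
    MvPolynomial.aeval (dualPoint A) (fstCoordPoly k n n' c) = dualPoint A.toBlocks₁₁ c := by
  rcases c with ⟨i, j⟩ | ⟨⟩
  · simp only [fstCoordPoly, MvPolynomial.aeval_X, dualPoint, tangentCoord, glCoordFun_inl,
      Units.val_one, Sum.elim_inl, toBlocks₁₁, of_apply]
    by_cases hij : i = j
    · subst hij; simp
    · simp [hij]
  · simp only [fstCoordPoly, map_mul, MvPolynomial.aeval_X]
    have hdet : MvPolynomial.aeval (dualPoint A) (genericBlock₂₂ k n n').det =
        inl 1 + inr (A.toBlocks₂₂.trace) := by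
      rw [show MvPolynomial.aeval (dualPoint A) (genericBlock₂₂ k n n').det =
          ((MvPolynomial.aeval (dualPoint A)).toRingHom.mapMatrix (genericBlock₂₂ k n n')).det from
        (RingHom.map_det _ _), ← det_dualMatrix]
      congr 1
      refine Matrix.ext fun i j => ?_
      simp only [RingHom.mapMatrix_apply, Matrix.map_apply, genericBlock₂₂, of_apply,
        AlgHom.toRingHom_eq_coe, RingHom.coe_coe, MvPolynomial.aeval_X, dualMatrix, dualPoint,
        tangentCoord, glCoordFun_inl, Units.val_one, Sum.elim_inl, Matrix.add_apply,
        Matrix.map_apply, toBlocks₂₂, Matrix.one_apply, Sum.inr.injEq]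
      by_cases hij : i = j
      · subst hij; simp [TrivSqZeroExt.inl_one]
      · simp [hij]
    rw [hdet]
    simp only [dualPoint, tangentCoord, glCoordFun_inr, Units.val_one, det_one, inv_one,
      Sum.elim_inr]
    have etr : A.trace = A.toBlocks₁₁.trace + A.toBlocks₂₂.trace := by
      conv_lhs => rw [← fromBlocks_toBlocks A]
      rw [trace_fromBlocks]
    rw [etr]
    ext <;> simp

/-- The same for the second block. [folklore] -/
theorem aeval_dualPoint_sndCoordPoly (A : Matrix (n ⊕ n') (n ⊕ n') k) (c : GLCoord n') :
    MvPolynomial.aeval (dualPoint A) (sndCoordPoly k n n' c) = dualPoint A.toBlocks₂₂ c := by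
  rcases c with ⟨i, j⟩ | ⟨⟩
  · simp only [sndCoordPoly, MvPolynomial.aeval_X, dualPoint, tangentCoord, glCoordFun_inl,
      Units.val_one, Sum.elim_inl, toBlocks₂₂, of_apply]
    by_cases hij : i = j
    · subst hij; simp
    · simp [hij]
  · simp only [sndCoordPoly, map_mul, MvPolynomial.aeval_X]
    have hdet : MvPolynomial.aeval (dualPoint A) (genericBlock₁₁ k n n').det =
        inl 1 + inr (A.toBlocks₁₁.trace) := by
      rw [show MvPolynomial.aeval (dualPoint A) (genericBlock₁₁ k n n').det =
          ((MvPolynomial.aeval (dualPoint A)).toRingHom.mapMatrix (genericBlock₁₁ k n n')).det from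
        (RingHom.map_det _ _), ← det_dualMatrix]
      congr 1
      refine Matrix.ext fun i j => ?_
      simp only [RingHom.mapMatrix_apply, Matrix.map_apply, genericBlock₁₁, of_apply,
        AlgHom.toRingHom_eq_coe, RingHom.coe_coe, MvPolynomial.aeval_X, dualMatrix, dualPoint,
        tangentCoord, glCoordFun_inl, Units.val_one, Sum.elim_inl, Matrix.add_apply,
        Matrix.map_apply, toBlocks₁₁, Matrix.one_apply, Sum.inl.injEq]
      by_cases hij : i = j
      · subst hij; simp [TrivSqZeroExt.inl_one]
      · simp [hij]
    rw [hdet]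
    simp only [dualPoint, tangentCoord, glCoordFun_inr, Units.val_one, det_one, inv_one,
      Sum.elim_inr]
    have etr : A.trace = A.toBlocks₁₁.trace + A.toBlocks₂₂.trace := by
      conv_lhs => rw [← fromBlocks_toBlocks A]
      rw [trace_fromBlocks]
    rw [etr]
    ext <;> simp

variable {G : Subgroup (GL n k)} {G' : Subgroup (GL n' k)}

/-- If `p` vanishes on `G` then `p ∘ fstCoordPoly` vanishes on `G × G'`. [folklore] -/
lemma aeval_fstCoordPoly_mem_vanishingIdeal {p : MvPolynomial (GLCoord n) k}
    (hp : p ∈ MvPolynomial.vanishingIdeal k (glCoordFun '' (G : Set (GL n k)))) :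
    MvPolynomial.aeval (fstCoordPoly k n n') p ∈
      MvPolynomial.vanishingIdeal k (glCoordFun '' (prodBlock G G' : Set (GL (n ⊕ n') k))) := by
  rw [MvPolynomial.mem_vanishingIdeal_iff] at hp ⊢
  rintro _ ⟨x, hx, rfl⟩
  obtain ⟨g, hg, g', hg', rfl⟩ := mem_prodBlock_iff.1 hx
  rw [show (MvPolynomial.aeval (glCoordFun (blockDiagGL (g, g') : GL (n ⊕ n') k)))
      (MvPolynomial.aeval (fstCoordPoly k n n') p) =
      MvPolynomial.eval (glCoordFun (blockDiagGL (g, g') : GL (n ⊕ n') k))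
        (MvPolynomial.aeval (fstCoordPoly k n n') p) from rfl, eval_aeval_fstCoordPoly]
  exact hp _ ⟨g, hg, rfl⟩

/-- If `p` vanishes on `G'` then `p ∘ sndCoordPoly` vanishes on `G × G'`. [folklore] -/
lemma aeval_sndCoordPoly_mem_vanishingIdeal {p : MvPolynomial (GLCoord n') k}
    (hp : p ∈ MvPolynomial.vanishingIdeal k (glCoordFun '' (G' : Set (GL n' k)))) :
    MvPolynomial.aeval (sndCoordPoly k n n') p ∈
      MvPolynomial.vanishingIdeal k (glCoordFun '' (prodBlock G G' : Set (GL (n ⊕ n') k))) := by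
  rw [MvPolynomial.mem_vanishingIdeal_iff] at hp ⊢
  rintro _ ⟨x, hx, rfl⟩
  obtain ⟨g, hg, g', hg', rfl⟩ := mem_prodBlock_iff.1 hx
  rw [show (MvPolynomial.aeval (glCoordFun (blockDiagGL (g, g') : GL (n ⊕ n') k)))
      (MvPolynomial.aeval (sndCoordPoly k n n') p) =
      MvPolynomial.eval (glCoordFun (blockDiagGL (g, g') : GL (n ⊕ n') k))
        (MvPolynomial.aeval (sndCoordPoly k n n') p) from rfl, eval_aeval_sndCoordPoly]
  exact hp _ ⟨g', hg', rfl⟩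

/-- **The first block of an element of `Lie(G × G')` lies in `Lie(G)`** (Springer 4.4.10 (3):
the differential of the projection `G × G' → G`). [folklore] -/
theorem toBlocks₁₁_mem_lieAlgebraGL {A : Matrix (n ⊕ n') (n ⊕ n') k}
    (hA : A ∈ lieAlgebraGL (prodBlock G G')) : A.toBlocks₁₁ ∈ lieAlgebraGL G := by
  rw [mem_lieAlgebraGL_iff_aeval] at hA ⊢
  intro p hp
  have h := hA _ (aeval_fstCoordPoly_mem_vanishingIdeal (G' := G') hp)
  have e := DFunLike.congr_fun
    (MvPolynomial.comp_aeval (f := fstCoordPoly k n n') (MvPolynomial.aeval (dualPoint A))) p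
  have e2 : (fun c => MvPolynomial.aeval (dualPoint A) (fstCoordPoly k n n' c)) =
      dualPoint A.toBlocks₁₁ := funext (aeval_dualPoint_fstCoordPoly A)
  rw [AlgHom.comp_apply, e2] at e
  rw [← e]
  exact h

/-- **The second block of an element of `Lie(G × G')` lies in `Lie(G')`.** [folklore] -/
theorem toBlocks₂₂_mem_lieAlgebraGL {A : Matrix (n ⊕ n') (n ⊕ n') k}
    (hA : A ∈ lieAlgebraGL (prodBlock G G')) : A.toBlocks₂₂ ∈ lieAlgebraGL G' := by
  rw [mem_lieAlgebraGL_iff_aeval] at hA ⊢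
  intro p hp
  have h := hA _ (aeval_sndCoordPoly_mem_vanishingIdeal (G := G) hp)
  have e := DFunLike.congr_fun
    (MvPolynomial.comp_aeval (f := sndCoordPoly k n n') (MvPolynomial.aeval (dualPoint A))) p
  have e2 : (fun c => MvPolynomial.aeval (dualPoint A) (sndCoordPoly k n n' c)) =
      dualPoint A.toBlocks₂₂ := funext (aeval_dualPoint_sndCoordPoly A)
  rw [AlgHom.comp_apply, e2] at e
  rw [← e]
  exact h

/-- **The off-diagonal blocks of an element of `Lie(G × G')` vanish** (the off-diagonal
coordinates vanish on `G × G'` and are their own differentials). [folklore] -/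
theorem toBlocks₁₂_eq_zero_of_mem_lieAlgebraGL {A : Matrix (n ⊕ n') (n ⊕ n') k}
    (hA : A ∈ lieAlgebraGL (prodBlock G G')) : A.toBlocks₁₂ = 0 ∧ A.toBlocks₂₁ = 0 := by
  rw [mem_lieAlgebraGL_iff] at hA
  have hoff : ∀ p ∈ offDiagPolys n n' k,
      p ∈ MvPolynomial.vanishingIdeal k (glCoordFun '' (prodBlock G G' : Set (GL (n ⊕ n') k))) := by
    intro p hp
    rw [MvPolynomial.mem_vanishingIdeal_iff]
    rintro _ ⟨x, hx, rfl⟩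
    obtain ⟨g, -, g', -, rfl⟩ := mem_prodBlock_iff.1 hx
    exact eval_offDiag_eq_zero _ hp
  constructor
  · ext i j
    have h := hA _ (hoff _ (Or.inl ⟨(i, j), rfl⟩))
    rw [tangentDeriv_X] at h
    simpa [tangentCoord, Matrix.toBlocks₁₂] using h
  · ext i j
    have h := hA _ (hoff _ (Or.inr ⟨(i, j), rfl⟩))
    rw [tangentDeriv_X] at h
    simpa [tangentCoord, Matrix.toBlocks₂₁] using h

/-- **`Lie(G × G') ⊆ Lie(G) ⊕ Lie(G')`**: an element of `Lie(G × G')` is the block diagonal of its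
two diagonal blocks, which lie in `Lie(G)`, resp. `Lie(G')`. (Equality holds as well but is not
needed.) [folklore] -/
theorem eq_fromBlocks_of_mem_lieAlgebraGL_prodBlock {A : Matrix (n ⊕ n') (n ⊕ n') k}
    (hA : A ∈ lieAlgebraGL (prodBlock G G')) :
    A = fromBlocks A.toBlocks₁₁ 0 0 A.toBlocks₂₂ ∧ A.toBlocks₁₁ ∈ lieAlgebraGL G ∧
      A.toBlocks₂₂ ∈ lieAlgebraGL G' := by
  obtain ⟨h₁₂, h₂₁⟩ := toBlocks₁₂_eq_zero_of_mem_lieAlgebraGL hA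
  refine ⟨?_, toBlocks₁₁_mem_lieAlgebraGL hA, toBlocks₂₂_mem_lieAlgebraGL hA⟩
  conv_lhs => rw [← fromBlocks_toBlocks A]
  rw [h₁₂, h₂₁]

/-- The same for a subgroup `H ≤ G × G'` (`Lie` is monotone). [folklore] -/
theorem eq_fromBlocks_of_mem_lieAlgebraGL_of_le {H : Subgroup (GL (n ⊕ n') k)} (hH : H ≤ prodBlock G G')
    {A : Matrix (n ⊕ n') (n ⊕ n') k} (hA : A ∈ lieAlgebraGL H) :
    A = fromBlocks A.toBlocks₁₁ 0 0 A.toBlocks₂₂ ∧ A.toBlocks₁₁ ∈ lieAlgebraGL G ∧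
      A.toBlocks₂₂ ∈ lieAlgebraGL G' :=
  eq_fromBlocks_of_mem_lieAlgebraGL_prodBlock (lieAlgebraGL_mono hH hA)

/-- An element of `Lie(G × 1)` has vanishing second block, so is determined by its first block;
in particular `Lie(1 × G') ∩ {A | A₂₂ = 0} = 0`-type statements: if `A ∈ Lie(H)` with
`H ≤ 1 × G'` and `A₂₂ = 0` then `A = 0`. [folklore] -/
theorem eq_zero_of_mem_lieAlgebraGL_of_le_inr {H : Subgroup (GL (n ⊕ n') k)}
    (hH : H ≤ prodBlock (⊥ : Subgroup (GL n k)) G') {A : Matrix (n ⊕ n') (n ⊕ n') k}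
    (hA : A ∈ lieAlgebraGL H) (h₂₂ : A.toBlocks₂₂ = 0) : A = 0 := by
  obtain ⟨eA, h₁₁, -⟩ := eq_fromBlocks_of_mem_lieAlgebraGL_of_le hH hA
  rw [lieAlgebraGL_bot, Submodule.mem_bot] at h₁₁
  rw [eA, h₁₁, h₂₂, fromBlocks_zero]

/-- Symmetrically for `H ≤ G × 1`. [folklore] -/
theorem eq_zero_of_mem_lieAlgebraGL_of_le_inl {H : Subgroup (GL (n ⊕ n') k)}
    (hH : H ≤ prodBlock G (⊥ : Subgroup (GL n' k))) {A : Matrix (n ⊕ n') (n ⊕ n') k}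
    (hA : A ∈ lieAlgebraGL H) (h₁₁ : A.toBlocks₁₁ = 0) : A = 0 := by
  obtain ⟨eA, -, h₂₂⟩ := eq_fromBlocks_of_mem_lieAlgebraGL_of_le hH hA
  rw [lieAlgebraGL_bot, Submodule.mem_bot] at h₂₂
  rw [eA, h₁₁, h₂₂, fromBlocks_zero]

end Lie

/-! ### Semisimple elements -/

section Semisimple

/-- A block-diagonal element with diagonal blocks is diagonal. [folklore] -/
lemma blockDiagGL_diagonal_mem_diagonalSubgroup (d : n → kˣ) (d' : n' → kˣ) :
    blockDiagGL (diagonalGL n k d, diagonalGL n' k d') ∈ diagonalSubgroup (n ⊕ n') k := by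
  refine ⟨Sum.elim d d', Units.ext ?_⟩
  simp only [coe_diagonalGL, coe_blockDiagGL, fromBlocks_diagonal]
  congr 1
  funext i
  cases i <;> rfl

/-- `blockDiagGL` maps `𝔻_n × 𝔻_{n'}` into `𝔻_{n+n'}`. [folklore] -/
lemma blockDiagGL_mem_diagonalSubgroup {a : GL n k} {b : GL n' k} (ha : a ∈ diagonalSubgroup n k)
    (hb : b ∈ diagonalSubgroup n' k) : blockDiagGL (a, b) ∈ diagonalSubgroup (n ⊕ n') k := by
  obtain ⟨d, rfl⟩ := ha
  obtain ⟨d', rfl⟩ := hb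
  exact blockDiagGL_diagonal_mem_diagonalSubgroup d d'

/-- **A block-diagonal element whose blocks lie in commutative groups of semisimple elements is
semisimple** (over an algebraically closed field): both groups are conjugate into the diagonal
matrices (`exists_conj_le_diagonalSubgroup`), so the element is conjugate to a diagonal one.
[folklore] -/
theorem isSemisimpleElt_blockDiagGL_of_mem [IsAlgClosed k] {T : Subgroup (GL n k)}
    {T' : Subgroup (GL n' k)} (hT : IsMulCommutative ↥T) (hTs : ∀ t ∈ T, IsSemisimpleElt t)
    (hT' : IsMulCommutative ↥T') (hT's : ∀ t ∈ T', IsSemisimpleElt t) {a : GL n k} {b : GL n' k}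
    (ha : a ∈ T) (hb : b ∈ T') : IsSemisimpleElt (blockDiagGL (a, b)) := by
  obtain ⟨P, hP⟩ := exists_conj_le_diagonalSubgroup hT hTs
  obtain ⟨P', hP'⟩ := exists_conj_le_diagonalSubgroup hT' hT's
  have haP : P * a * P⁻¹ ∈ diagonalSubgroup n k := hP ⟨a, ha, rfl⟩
  have hbP : P' * b * P'⁻¹ ∈ diagonalSubgroup n' k := hP' ⟨b, hb, rfl⟩
  have hdiag := isSemisimpleElt_of_mem_diagonalSubgroup (blockDiagGL_mem_diagonalSubgroup haP hbP)
  have e : blockDiagGL (a, b) =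
      (blockDiagGL (P, P'))⁻¹ * blockDiagGL (P * a * P⁻¹, P' * b * P'⁻¹) * ((blockDiagGL (P, P'))⁻¹)⁻¹ := by
    rw [inv_inv, ← map_inv, ← map_mul, ← map_mul]
    congr 1
    ext <;> simp [mul_assoc]
  rw [e]
  exact hdiag.conj _

end Semisimple

end Literature.NumberTheory.Automorphic

end
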